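import Summits.HodgeConjecture.HodgeCM.Model.LiuIndexCentralType_2
import Literature.NumberTheory.Automorphic.UnitaryGroupAdelicCharactersDetPair
import Literature.NumberTheory.Automorphic.Liu2021.Def411WeilCarriersCentralTypeGaussian
import Literature.NumberTheory.Automorphic.Liu2021.Def411WeilCarriersCentralTypeGaussianSupply
import Literature.NumberTheory.Weil1964.ArchDualPairLineSignCount
import Summits.HodgeConjecture.CorCM.B01.Transposition.Item6GaussianTestFunction
import Literature.NumberTheory.Automorphic.AdelicTensorStripping
import Literature.NumberTheory.Weil1964.ArchFollandCompactKType
import HarnessLib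

/-!
# X3-Char item (E) at the COR-CM pin: the central type of the splitting attached to a character, and Liu's weight-one table

Cell pub-hodgecm2 (COR-CM), seat pin-3 (gen 9 draft, gen 10 landing), 2026-08-23.  Transport of the Literature theorems
`pairRep_chiSplittingLine_center_gaussianV_tmul_cm` ∕ `exists_weightOne_eq_chiSplittingLine_toHeckeCharacter_of_center_gaussianV_cm`
(`Liu2021/Def411WeilCarriersCentralTypeGaussian[Supply]`, ✔ p350403 ∕ p351353) and of the sign count
`central_line_weightOneType_table_of_deltaPos'` (`Weil1964/ArchDualPairLineSignCount`, ✔ p351026) to the package's index currency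
`HodgeCM.Model.LiuIndex.HasCentralTypeAt V a s m` (port layer L69 `HodgeCM/Model/LiuIndexCentralType`), through the two junctions
(J1) `follandFock (cmBigFrame … ι₁) 1 = gaussianV …` and (J2) `testFun Φ x₀ N = Φ ⊗ 𝟙_{coset}` of `Transposition/Item6GaussianTestFunction`
(✔ p350802):

* `testFun_gaussianAt_eq_piSchwartzBruhatEquiv_tmul` — (J1)+(J2): the thin-coset test functions of the package Gaussian `gaussianAt V a`
  are the pure tensors `G_𝕍 ⊗ 𝟙_{coset}`;
* `hasCentralTypeAt_chiSplittingLine` — for every `χ` (unitary, `χ|_{𝕀_{L⁺}} = ε`) of odd unitary archimedean type `(τ, 0)`, the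
  splitting `ι_χ = chiSplittingLine χ` of the line `⟨a⟩` over `V` HAS CENTRAL TYPE `centralType τ` (`= 3 (τ_w + 1)/2 − q_{v(w)}`);
* `exists_eq_chiSplittingLine_weightOne_of_hasCentralTypeAt` — conversely a continuous compatible splitting of central type
  `centralType (weightOneType Φ)` is `ι_{μ₀ ⊛ α}` of weight one with `Φ_{μ₀ ⊛ α} = Φ`;
* `centralType_weightOneType_of_deltaPos` — THE TABLE: for `Φ = Φ^δ(a)` cut out by `δ_L · a` ([Liu21, Def. 4.12]) on the signature
  `(2,1)`-at-`ι₁`, definite-elsewhere space `V`, `centralType (weightOneType Φ) = ∓𝟙_{mk ι₁}` (sign: `(mk ι₁).embedding ∈ Φ`);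
  `…_of_embedding_eq`: keyed on `ι₁` under E's `hemb : (mk ι₁).embedding = ι₁`, the condition is `0 < Im ι₁(δ_L a)` — the condition
  of the package table `LiuIndex.muLiu` (L72), whose `Φ^δ := SignRecipe.lineType` is cut out by `η_L = δ_L`;
* `hasCentralTypeAt_chiSplittingLine_toHeckeCharacter_weightOneType` ∕
  `exists_weightOne_eq_chiSplittingLine_toHeckeCharacter_of_hasCentralTypeAt_weightOneType` — X3-Char item (E) at the pin for an ARBITRARY
  CM type `Φ`, both directions, NO analytic hypothesis and NO base character: the continuous compatible splittings of central type
  `centralType (weightOneType Φ)` over the line `⟨a⟩` are EXACTLY the `ι_{toHecke μ}`, `μ` conjugate symplectic OF WEIGHT ONE with `Φ_μ = Φ`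
  (existence of such `μ`: `IdeleClassGroup.exists_isConjugateSymplectic_hasCMType`; the rank-3 det-factorisation (A):
  `AdelicCharactersDet.centralCharFactorsThroughDet_rank_three`);
* `hasCentralTypeAt_chiSplittingLine_toHeckeCharacter` ∕ `exists_weightOne_eq_chiSplittingLine_toHeckeCharacter_of_hasCentralTypeAt` —
  the same at `Φ = Φ^δ(a)` in the table currency `∓𝟙_{mk ι₁}` (the package recipe `LiuIndex.muLiu` under `hemb`, port layer L72).

KERNEL only (theorems; `maxHeartbeats` raised on the four statements that spell `chiSplittingLine` at the `CMField` pin, as in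
`Transposition/Item6OmegaMuSplitting`).  HC_CM is NOT proved here or anywhere; nothing here inhabits `hLiu ∕ hM`; no pointer moves.
-/

set_option autoImplicit false

noncomputable section

namespace Summit.HodgeConjecture.CorCM.Transposition.CentralTypeAtPin

open NumberField NumberField.InfinitePlace NumberField.mixedEmbedding IsDedekindDomain
open scoped Matrix SchwartzMap Classical TensorProduct
open Literature.NumberTheory.Automorphic Literature.NumberTheory.Automorphic.UnitaryGroup Literature.NumberTheory.Weil1964
open Literature.NumberTheory.GelbartRogawski1991 Literature.NumberTheory.GelbartRogawski1991.UnitaryDualPair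
open Literature.NumberTheory.GelbartRogawski1991.GRConstruction
open Literature.NumberTheory.Automorphic.Liu2021.Def411WeilCarriersDoubling
open Literature.NumberTheory.Automorphic.IdeleClassGroup
open Literature.NumberTheory.Automorphic.UnitaryGroup.AdelicCharactersArchType (twist)
open Literature.NumberTheory.GelbartRogawski1991.GRConstruction.DoubledWeilDetTwist
open Literature.Analysis.SegalBargmann
open Literature.NumberTheory.GaloisRepresentations
open Literature.RepresentationTheory.HarrisKudlaSweet1996
open HodgeCM HodgeCM.Model HodgeCM.Model.LiuIndex
open HodgeCM.Model.SupplyInstance (testFun finEmb coe_testFun)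

-- (J1)/(J2): `Summit.HodgeConjecture.CorCM.Transposition.GaussianTestFunction` (p350802 `Transposition/Item6GaussianTestFunction.lean`)
open Summit.HodgeConjecture.CorCM.Transposition.GaussianTestFunction


/-! ## The central type of `ι_χ` at the pin -/

open HodgeCM.Model.ArchSideTerm (e₁)

variable {L : CMField} {ι₁ : (L : Type) →+* ℂ} (V : HermSpace3 L ι₁)

/-- (J1)+(J2) at the pin: the thin-coset test function `φ_N(x₀)` of the package Gaussian `gaussianAt V a` is the pure tensor
`G_𝕍 ⊗ 𝟙_{coset}` of the Literature Gaussian (p350802 `follandFock_cmBigFrame_one_eq_gaussianV`, `testFun_eq_piSchwartzBruhatEquiv_tmul`). [folklore] -/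
theorem testFun_gaussianAt_eq_piSchwartzBruhatEquiv_tmul (a : RealScalar L) (x₀ : Fin 3 → ↥(maximalRealSubfield L)) (Nl : ℕ) :
    testFun (↥(maximalRealSubfield L)) (Fin 3) (gaussianAt V a) x₀ Nl =
      piSchwartzBruhatEquiv (↥(maximalRealSubfield L)) (Fin 3)
        (gaussianV (L : Type) e₁ (frameD V) (frameD_real V) (frameD_ne V) (RealScalar.vec a) (RealScalar.vec_real a) (RealScalar.vec_ne a) ⊗ₜ
          finTranslateSB (↥(maximalRealSubfield L)) (Fin 3) (-finEmb (↥(maximalRealSubfield L)) (Fin 3) x₀)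
            (indicatorSB (↥(maximalRealSubfield L)) (Fin 3) (piLevelIdeal (↥(maximalRealSubfield L)) (Fin 3) (Ideal.span {(Nl : 𝓞 _)}))
              (isOpen_piLevelIdeal _ _) (isCompact_piLevelIdeal _ (Fin 3) _))) := by
  rw [testFun_eq_piSchwartzBruhatEquiv_tmul, gaussianAt_def, follandFock_cmBigFrame_one_eq_gaussianV]

set_option maxHeartbeats 4000000 in
/-- **`ι_χ = chiSplittingLine χ` at the scalar `a` HAS CENTRAL TYPE `centralType τ`** for every `χ` (unitary, `χ|_{𝕀_{L⁺}} = ε`) of odd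
unitary archimedean type `(τ, 0)` — the analytic input (E1) of the X3-Char item, in the package's `HasCentralTypeAt` currency
(`centralType τ w = 3 (τ_w + 1)/2 − q_{v(w)}`, `q_v` the number of negative signs of `frameD V ⊗ ⟨a⟩` at `v`). [folklore] -/
theorem hasCentralTypeAt_chiSplittingLine (a : RealScalar L) {χ : HeckeCharacter (L : Type)} (hχu : χ.IsUnitary)
    (hχs : IsSplittingChar (L : Type) 1 χ) {τ : InfinitePlace (L : Type) → ℤ} (hτ : χ.HasUnitaryArchType τ 0) (hodd : ∀ w, Odd (τ w)) :
    HasCentralTypeAt V a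
      (chiSplittingLine (L : Type) e₁ (frameD V) (frameD_real V) (frameD_ne V) χ hχu hχs
        (realDiagonal (L : Type) (RealScalar.vec a) (RealScalar.vec_real a))
        (isUnit_det_realDiagonal (L : Type) (RealScalar.vec a) (RealScalar.vec_real a) (RealScalar.vec_ne a))
        (Matrix.diagonal (RealScalar.vec a)) (realDiagonal_map (L : Type) (RealScalar.vec a) (RealScalar.vec_real a)).symm)
      (centralType (L : Type) e₁ (frameD V) (frameD_real V) (RealScalar.vec a) (RealScalar.vec_real a) τ) := by
  intro t x₀ Nl
  have hG := testFun_gaussianAt_eq_piSchwartzBruhatEquiv_tmul V a x₀ Nl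
  exact ((congrArg _ hG).trans (pairRep_chiSplittingLine_center_gaussianV_tmul_cm (L : Type) (frameD V) (frameD_real V) (frameD_ne V) e₁
    hχu hχs hτ hodd (RealScalar.vec a) (RealScalar.vec_real a) (RealScalar.vec_ne a) t _)).trans (congrArg _ hG.symm)

set_option maxHeartbeats 4000000 in
/-- **X3-CHAR ITEM (E) AT THE PIN, NO ANALYTIC HYPOTHESIS**: at a Gram scalar `a`, every CONTINUOUS compatible pair splitting `s` with
`HasCentralTypeAt V a s (centralType (weightOneType Φ))` — the central type of `ι_{μ₀}` for any `μ₀` conjugate symplectic of weight one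
with CM type `Φ` — is `ι_{toHecke μ}` for `μ := μ₀ ⊛ α` conjugate symplectic OF WEIGHT ONE with `Φ_μ = Φ` (g8's
`exists_eq_chiSplittingLine_weightOne_of_hasCentralTypeAt` with its `href` discharged by `hasCentralTypeAt_chiSplittingLine`). [folklore] -/
theorem exists_eq_chiSplittingLine_weightOne_of_hasCentralTypeAt (a : RealScalar L)
    (μ₀ : Literature.NumberTheory.Automorphic.IdeleClassGroup (L : Type) →ₜ* Circle) (hμ₀ : IsConjugateSymplectic (L : Type) μ₀)
    (hw : HasWeight (L : Type) μ₀ 1) {Φ : Literature.AlgebraicGeometry.Motives.CMType (L : Type)}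
    (hΦ : HasCMType (L : Type) μ₀ Φ)
    (s : SplittingAt V a) (hsc : Continuous s) (hs : IsCompatAtScalar V a s)
    (hP : HasCentralTypeAt V a s
      (centralType (L : Type) e₁ (frameD V) (frameD_real V) (RealScalar.vec a) (RealScalar.vec_real a) (weightOneType (L : Type) Φ))) :
    ∃ (α : CMAdelicOne (L : Type) →* ℂˣ) (hα : Continuous α)
      (hαrat : ∀ u : CMAdelicOne (L : Type),
        (u : Literature.NumberTheory.GaloisRepresentations.ideleGroup (L : Type)) ∈
          Literature.NumberTheory.GaloisRepresentations.principalIdeles (L : Type) → α u = 1)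
      (hαu : ∀ u, ‖((α u : ℂˣ) : ℂ)‖ = 1)
      (hμ : IsConjugateSymplectic (L : Type) (twist (L : Type) α hα hαrat μ₀)),
      s = chiSplittingLine (L : Type) e₁ (frameD V) (frameD_real V) (frameD_ne V)
            (toHeckeCharacter (L : Type) μ₀ * ratioHecke (L : Type) α hα hαrat)
            (isUnitary_mul_ratioHecke (L : Type) (isUnitary_toHeckeCharacter (L : Type) μ₀) hα hαrat hαu)
            ((isSplittingChar_mul_ratioHecke_iff (L : Type) 1 _ hα hαrat).2
              (isSplittingChar_toHeckeCharacter_of_isConjugateSymplectic (L : Type) μ₀ hμ₀))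
            (realDiagonal (L : Type) (RealScalar.vec a) (RealScalar.vec_real a))
            (isUnit_det_realDiagonal (L : Type) (RealScalar.vec a) (RealScalar.vec_real a) (RealScalar.vec_ne a))
            (Matrix.diagonal (RealScalar.vec a)) (realDiagonal_map (L : Type) (RealScalar.vec a) (RealScalar.vec_real a)).symm ∧
        HasWeight (L : Type) (twist (L : Type) α hα hαrat μ₀) 1 ∧ hμ.cmType = Φ := by
  obtain ⟨x₀, hx₀⟩ := exists_testFun_gaussianAt_ne_zero V a
  -- the test function `φ_1(x₀)` of the Gaussian is the pure tensor `G_𝕍 ⊗ f₀` with `f₀ ≠ 0`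
  have hG := testFun_gaussianAt_eq_piSchwartzBruhatEquiv_tmul V a x₀ 1
  have hf : finTranslateSB (↥(maximalRealSubfield L)) (Fin 3) (-finEmb (↥(maximalRealSubfield L)) (Fin 3) x₀)
      (indicatorSB (↥(maximalRealSubfield L)) (Fin 3) (piLevelIdeal (↥(maximalRealSubfield L)) (Fin 3) (Ideal.span {((1 : ℕ) : 𝓞 _)}))
        (isOpen_piLevelIdeal _ _) (isCompact_piLevelIdeal _ (Fin 3) _)) ≠ 0 := by
    intro h0
    apply hx₀
    rw [hG, h0, TensorProduct.tmul_zero, map_zero]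
  obtain ⟨α, hα, hαrat, hαu, hμ, hsα, -, hw', hΦ'⟩ :=
    exists_eq_chiSplittingLine_twist_weightOne_of_center_gaussianV_cm (L : Type) (frameD V) (frameD_real V) (frameD_ne V) e₁
      (RealScalar.vec a) (RealScalar.vec_real a) (RealScalar.vec_ne a) μ₀ hμ₀
      (AdelicCharactersDet.centralCharFactorsThroughDet_rank_three (L : Type) e₁ (frameD V) (frameD_real V) (frameD_ne V)
        (Matrix.diagonal (RealScalar.vec a)) (by simpa using RealScalar.vec_real a 0) (by simpa using RealScalar.vec_ne a 0) _)
      hw hΦ hsc hs hf (fun t => by simpa only [hG] using hP t x₀ 1)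
  exact ⟨α, hα, hαrat, hαu, hμ, hsα, hw', hΦ'⟩


/-! ## The weight-one table at the pin: `centralType (weightOneType Φ^δ(a)) = ∓𝟙_{w₁}` -/

/-- **THE WEIGHT-ONE CENTRAL TYPE AT THE PIN IS LIU'S TABLE**: on the hermitian 3-space `V` (signature `(2,1)` at the place of `ι₁`,
definite elsewhere, read on the frame of record `frameD V`) and the line `⟨a⟩`, for the CM type `Φ = Φ^δ(a)` CUT OUT by `δ_L · a`
(`φ ∈ Φ ↔ 0 < Im φ(δ_L a)`, [Liu21, Def. 4.12]) the central type of the weight-one type of `Φ` is `0` at every place `w ≠ w₁ := mk ι₁`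
and `weightOneType Φ w₁ = ∓1` at `w₁` according as `w₁.embedding ∈ Φ` or not (mc-theta-3's ✔ p351026
`central_line_weightOneType_table_of_deltaPos'` with the frame signs `frameD_sign_ι₁` ∕ `frameD_pos_of_ne`). [folklore] -/
theorem centralType_weightOneType_of_deltaPos (a : RealScalar L) (Φ : Literature.AlgebraicGeometry.Motives.CMType (L : Type))
    (hΦ : ∀ φ : (L : Type) →+* ℂ, φ ∈ Φ.1 ↔ 0 < (φ (imagUnit (L : Type) * a.1)).im) :
    centralType (L : Type) e₁ (frameD V) (frameD_real V) (RealScalar.vec a) (RealScalar.vec_real a) (weightOneType (L : Type) Φ) =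
      if (InfinitePlace.mk ι₁).embedding ∈ Φ.1 then -Pi.single (InfinitePlace.mk ι₁) 1 else Pi.single (InfinitePlace.mk ι₁) 1 := by
  -- the place of `ι₁` and the signs of the frame of record, in the `cmPlaceOver` currency
  have hι₁ : (InfinitePlace.mk ι₁).comap (algebraMap ↥(maximalRealSubfield (L : Type)) (L : Type)) =
      (HypCensus.cmPlace (L : Type) ι₁).1 := rfl
  have hw₁ : (cmPlaceOver (L : Type) (HypCensus.cmPlace (L : Type) ι₁)).1 = InfinitePlace.mk ι₁ :=
    cmPlaceOver_eq_mk (L : Type) _ ι₁ hι₁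
  obtain ⟨i₀, hneg, hpos₁⟩ := frameD_sign_ι₁ V
  have hneg' : ((cmPlaceOver (L : Type) (HypCensus.cmPlace (L : Type) ι₁)).1.embedding (frameD V i₀)).re < 0 := by
    rwa [← re_embedding_eq_re_embedding_cmPlaceOver (L : Type) _ ι₁ hι₁ (frameD V) (frameD_real V) i₀]
  have hpos₁' : ∀ i, i ≠ i₀ → 0 < ((cmPlaceOver (L : Type) (HypCensus.cmPlace (L : Type) ι₁)).1.embedding (frameD V i)).re :=
    fun i hi => by
    rw [← re_embedding_eq_re_embedding_cmPlaceOver (L : Type) _ ι₁ hι₁ (frameD V) (frameD_real V) i]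
    exact hpos₁ i hi
  have hpos' : ∀ v, v ≠ HypCensus.cmPlace (L : Type) ι₁ → ∀ i, 0 < ((cmPlaceOver (L : Type) v).1.embedding (frameD V i)).re :=
    fun v hv i => by
    refine frameD_pos_of_ne V _ (fun h => hv (Subtype.ext ?_)) i
    rw [← cmPlaceOver_comap (L : Type) v, ← hι₁, ← h, mk_embedding]
  have hrp : ∀ v : {v : InfinitePlace ↥(maximalRealSubfield (L : Type)) // v.IsReal},
      realPlaceUnder (L : Type) (cmPlaceOver (L : Type) v).1 = v :=
    fun v => (realPlaceEquiv (L : Type)).symm_apply_apply v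
  funext w
  obtain ⟨v, rfl⟩ : ∃ v : {v : InfinitePlace ↥(maximalRealSubfield (L : Type)) // v.IsReal}, (cmPlaceOver (L : Type) v).1 = w :=
    ⟨(realPlaceEquiv (L : Type)).symm w, (realPlaceEquiv (L : Type)).apply_symm_apply w⟩
  have key := central_line_weightOneType_table_of_deltaPos' (L : Type) e₁ (frameD V) (frameD_real V) (RealScalar.vec a)
    (RealScalar.vec_real a) (RealScalar.vec_ne a 0) Φ hΦ (HypCensus.cmPlace (L : Type) ι₁) i₀ hneg' hpos₁' hpos' v
  have key' : centralType (L : Type) e₁ (frameD V) (frameD_real V) (RealScalar.vec a) (RealScalar.vec_real a)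
      (weightOneType (L : Type) Φ) (cmPlaceOver (L : Type) v).1 =
      if v = HypCensus.cmPlace (L : Type) ι₁ then weightOneType (L : Type) Φ (cmPlaceOver (L : Type) (HypCensus.cmPlace (L : Type) ι₁)).1
      else 0 := by
    rw [← key]
    unfold centralType
    rw [hrp]
    rfl
  rw [key']
  have hinj : (cmPlaceOver (L : Type) v).1 = InfinitePlace.mk ι₁ → v = HypCensus.cmPlace (L : Type) ι₁ := fun h =>
    (realPlaceEquiv (L : Type)).injective (h.trans hw₁.symm)
  by_cases hv : v = HypCensus.cmPlace (L : Type) ι₁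
  · subst hv
    rw [if_pos rfl, hw₁]
    unfold weightOneType
    split_ifs <;> simp
  · rw [if_neg hv]
    have hne : (cmPlaceOver (L : Type) v).1 ≠ InfinitePlace.mk ι₁ := fun h => hv (hinj h)
    split_ifs <;> simp [Pi.single_eq_of_ne hne]

/-- the same keyed on `ι₁` itself, under E's identification `hemb : (mk ι₁).embedding = ι₁` of the place's distinguished embedding
(then the membership is [Liu21, Def. 4.12]'s inequality `0 < Im ι₁(δ_L a)` — the condition of the package table `LiuIndex.muLiu`,
whose `Φ^δ(q) := SignRecipe.lineType` is cut out by `η_L = δ_L`). [folklore] -/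
theorem centralType_weightOneType_of_deltaPos_of_embedding_eq (a : RealScalar L)
    (Φ : Literature.AlgebraicGeometry.Motives.CMType (L : Type))
    (hΦ : ∀ φ : (L : Type) →+* ℂ, φ ∈ Φ.1 ↔ 0 < (φ (imagUnit (L : Type) * a.1)).im) (hemb : (InfinitePlace.mk ι₁).embedding = ι₁) :
    centralType (L : Type) e₁ (frameD V) (frameD_real V) (RealScalar.vec a) (RealScalar.vec_real a) (weightOneType (L : Type) Φ) =
      if 0 < (ι₁ (imagUnit (L : Type) * a.1)).im then -Pi.single (InfinitePlace.mk ι₁) 1 else Pi.single (InfinitePlace.mk ι₁) 1 := by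
  rw [centralType_weightOneType_of_deltaPos V a Φ hΦ, hemb]
  simp only [hΦ ι₁]

/-! ## X3-Char item (E) at the pin, both directions, for an arbitrary CM type `Φ` (central type `centralType (weightOneType Φ)`) -/

set_option maxHeartbeats 4000000 in
/-- **`ι_{μ₀}` has central type `centralType (weightOneType Φ_{μ₀})`**: for `μ₀` conjugate symplectic OF WEIGHT ONE with CM type `Φ`, the
splitting `ι_{toHecke μ₀}` of the line `⟨a⟩` over `V` has central type `centralType (weightOneType Φ)` (`hasCentralTypeAt_chiSplittingLine` at
`τ := weightOneType Φ`, the unitary archimedean type of `toHecke μ₀`). [folklore] -/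
theorem hasCentralTypeAt_chiSplittingLine_toHeckeCharacter_weightOneType (a : RealScalar L)
    (μ₀ : Literature.NumberTheory.Automorphic.IdeleClassGroup (L : Type) →ₜ* Circle) (hμ₀ : IsConjugateSymplectic (L : Type) μ₀)
    (hw : HasWeight (L : Type) μ₀ 1) {Φ : Literature.AlgebraicGeometry.Motives.CMType (L : Type)} (hΦμ : HasCMType (L : Type) μ₀ Φ) :
    HasCentralTypeAt V a
      (chiSplittingLine (L : Type) e₁ (frameD V) (frameD_real V) (frameD_ne V) (toHeckeCharacter (L : Type) μ₀)
        (isUnitary_toHeckeCharacter (L : Type) μ₀) (isSplittingChar_toHeckeCharacter_of_isConjugateSymplectic (L : Type) μ₀ hμ₀)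
        (realDiagonal (L : Type) (RealScalar.vec a) (RealScalar.vec_real a))
        (isUnit_det_realDiagonal (L : Type) (RealScalar.vec a) (RealScalar.vec_real a) (RealScalar.vec_ne a))
        (Matrix.diagonal (RealScalar.vec a)) (realDiagonal_map (L : Type) (RealScalar.vec a) (RealScalar.vec_real a)).symm)
      (centralType (L : Type) e₁ (frameD V) (frameD_real V) (RealScalar.vec a) (RealScalar.vec_real a) (weightOneType (L : Type) Φ)) :=
  hasCentralTypeAt_chiSplittingLine V a _ _
    ((hasUnitaryArchType_toHeckeCharacter_iff (L : Type) μ₀ _).2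
      (AdelicCharactersArchType.hasInfinityType_weightOneType_of_hasWeight_one (L : Type) hw hΦμ))
    (odd_weightOneType (L : Type) Φ)

set_option maxHeartbeats 4000000 in
/-- **every continuous compatible splitting of central type `centralType (weightOneType Φ)` IS `ι_μ`, `μ` OF WEIGHT ONE WITH `Φ_μ = Φ`** —
no base character in the statement (one exists by `IdeleClassGroup.exists_isConjugateSymplectic_hasCMType`, WeilBNT VII §3), no analytic
hypothesis ((A) for rank 3 = `AdelicCharactersDet.centralCharFactorsThroughDet_rank_three`). [folklore] -/
theorem exists_weightOne_eq_chiSplittingLine_toHeckeCharacter_of_hasCentralTypeAt_weightOneType (a : RealScalar L)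
    (Φ : Literature.AlgebraicGeometry.Motives.CMType (L : Type))
    (s : SplittingAt V a) (hsc : Continuous s) (hs : IsCompatAtScalar V a s)
    (hP : HasCentralTypeAt V a s
      (centralType (L : Type) e₁ (frameD V) (frameD_real V) (RealScalar.vec a) (RealScalar.vec_real a) (weightOneType (L : Type) Φ))) :
    ∃ (μ : Literature.NumberTheory.Automorphic.IdeleClassGroup (L : Type) →ₜ* Circle) (hμ : IsConjugateSymplectic (L : Type) μ),
      HasWeight (L : Type) μ 1 ∧ HasCMType (L : Type) μ Φ ∧
        s = chiSplittingLine (L : Type) e₁ (frameD V) (frameD_real V) (frameD_ne V) (toHeckeCharacter (L : Type) μ)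
              (isUnitary_toHeckeCharacter (L : Type) μ) (isSplittingChar_toHeckeCharacter_of_isConjugateSymplectic (L : Type) μ hμ)
              (realDiagonal (L : Type) (RealScalar.vec a) (RealScalar.vec_real a))
              (isUnit_det_realDiagonal (L : Type) (RealScalar.vec a) (RealScalar.vec_real a) (RealScalar.vec_ne a))
              (Matrix.diagonal (RealScalar.vec a)) (realDiagonal_map (L : Type) (RealScalar.vec a) (RealScalar.vec_real a)).symm := by
  obtain ⟨μ₀, hμ₀, hw, hΦμ⟩ := exists_isConjugateSymplectic_hasCMType (L := (L : Type)) Φ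
  obtain ⟨x₀, hx₀⟩ := exists_testFun_gaussianAt_ne_zero V a
  have hG := testFun_gaussianAt_eq_piSchwartzBruhatEquiv_tmul V a x₀ 1
  have hf : finTranslateSB (↥(maximalRealSubfield L)) (Fin 3) (-finEmb (↥(maximalRealSubfield L)) (Fin 3) x₀)
      (indicatorSB (↥(maximalRealSubfield L)) (Fin 3) (piLevelIdeal (↥(maximalRealSubfield L)) (Fin 3) (Ideal.span {((1 : ℕ) : 𝓞 _)}))
        (isOpen_piLevelIdeal _ _) (isCompact_piLevelIdeal _ (Fin 3) _)) ≠ 0 := by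
    intro h0
    apply hx₀
    rw [hG, h0, TensorProduct.tmul_zero, map_zero]
  exact exists_weightOne_eq_chiSplittingLine_toHeckeCharacter_of_center_gaussianV_cm (L : Type) e₁ (frameD V) (frameD_real V)
    (frameD_ne V) (RealScalar.vec a) (RealScalar.vec_real a) (RealScalar.vec_ne a) μ₀ hμ₀
    (AdelicCharactersDet.centralCharFactorsThroughDet_rank_three (L : Type) e₁ (frameD V) (frameD_real V) (frameD_ne V)
      (Matrix.diagonal (RealScalar.vec a)) (by simpa using RealScalar.vec_real a 0) (by simpa using RealScalar.vec_ne a 0) _)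
    hw hΦμ hsc hs hf (fun t => by simpa only [hG] using hP t x₀ 1)

/-! ## X3-Char item (E) at the pin, both directions, in the table currency -/

set_option maxHeartbeats 4000000 in
/-- **`ι_{μ₀}` HAS LIU'S CENTRAL TYPE**: for `μ₀` conjugate symplectic OF WEIGHT ONE with CM type `Φ = Φ^δ(a)`, the splitting
`ι_{toHecke μ₀}` of the line `⟨a⟩` over `V` has central type `∓𝟙_{mk ι₁}` (sign: `(mk ι₁).embedding ∈ Φ`) — the weight-one index
lines of [Liu21, Prop. 4.13] at the pin are inhabited by the characters [Liu21, Def. 4.3] quantifies over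
(`IdeleClassGroup.exists_isConjugateSymplectic_hasCMType`). [folklore] -/
theorem hasCentralTypeAt_chiSplittingLine_toHeckeCharacter (a : RealScalar L)
    (μ₀ : Literature.NumberTheory.Automorphic.IdeleClassGroup (L : Type) →ₜ* Circle) (hμ₀ : IsConjugateSymplectic (L : Type) μ₀)
    (hw : HasWeight (L : Type) μ₀ 1) {Φ : Literature.AlgebraicGeometry.Motives.CMType (L : Type)} (hΦμ : HasCMType (L : Type) μ₀ Φ)
    (hΦ : ∀ φ : (L : Type) →+* ℂ, φ ∈ Φ.1 ↔ 0 < (φ (imagUnit (L : Type) * a.1)).im) :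
    HasCentralTypeAt V a
      (chiSplittingLine (L : Type) e₁ (frameD V) (frameD_real V) (frameD_ne V) (toHeckeCharacter (L : Type) μ₀)
        (isUnitary_toHeckeCharacter (L : Type) μ₀) (isSplittingChar_toHeckeCharacter_of_isConjugateSymplectic (L : Type) μ₀ hμ₀)
        (realDiagonal (L : Type) (RealScalar.vec a) (RealScalar.vec_real a))
        (isUnit_det_realDiagonal (L : Type) (RealScalar.vec a) (RealScalar.vec_real a) (RealScalar.vec_ne a))
        (Matrix.diagonal (RealScalar.vec a)) (realDiagonal_map (L : Type) (RealScalar.vec a) (RealScalar.vec_real a)).symm)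
      (if (InfinitePlace.mk ι₁).embedding ∈ Φ.1 then -Pi.single (InfinitePlace.mk ι₁) 1 else Pi.single (InfinitePlace.mk ι₁) 1) := by
  rw [← centralType_weightOneType_of_deltaPos V a Φ hΦ]
  exact hasCentralTypeAt_chiSplittingLine_toHeckeCharacter_weightOneType V a μ₀ hμ₀ hw hΦμ

set_option maxHeartbeats 4000000 in
/-- **EVERY CONTINUOUS LINE OF LIU'S CENTRAL TYPE IS `ι_μ`, `μ` OF WEIGHT ONE WITH `Φ_μ = Φ^δ(a)`**: at the scalar `a`, a continuous
compatible pair splitting `s` over `V` of central type `∓𝟙_{mk ι₁}` (the table of `Φ = Φ^δ(a)`) IS `ι_{toHecke μ}` for a `μ`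
conjugate symplectic OF WEIGHT ONE with CM type `Φ` — no base character, no analytic hypothesis (the base character of
[Liu21, Def. 4.3] exists by `IdeleClassGroup.exists_isConjugateSymplectic_hasCMType`; the rank-3 det-factorisation (A) is
`AdelicCharactersDet.centralCharFactorsThroughDet_rank_three`). [folklore] -/
theorem exists_weightOne_eq_chiSplittingLine_toHeckeCharacter_of_hasCentralTypeAt (a : RealScalar L)
    (Φ : Literature.AlgebraicGeometry.Motives.CMType (L : Type))
    (hΦ : ∀ φ : (L : Type) →+* ℂ, φ ∈ Φ.1 ↔ 0 < (φ (imagUnit (L : Type) * a.1)).im)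
    (s : SplittingAt V a) (hsc : Continuous s) (hs : IsCompatAtScalar V a s)
    (hP : HasCentralTypeAt V a s
      (if (InfinitePlace.mk ι₁).embedding ∈ Φ.1 then -Pi.single (InfinitePlace.mk ι₁) 1 else Pi.single (InfinitePlace.mk ι₁) 1)) :
    ∃ (μ : Literature.NumberTheory.Automorphic.IdeleClassGroup (L : Type) →ₜ* Circle) (hμ : IsConjugateSymplectic (L : Type) μ),
      HasWeight (L : Type) μ 1 ∧ HasCMType (L : Type) μ Φ ∧
        s = chiSplittingLine (L : Type) e₁ (frameD V) (frameD_real V) (frameD_ne V) (toHeckeCharacter (L : Type) μ)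
              (isUnitary_toHeckeCharacter (L : Type) μ) (isSplittingChar_toHeckeCharacter_of_isConjugateSymplectic (L : Type) μ hμ)
              (realDiagonal (L : Type) (RealScalar.vec a) (RealScalar.vec_real a))
              (isUnit_det_realDiagonal (L : Type) (RealScalar.vec a) (RealScalar.vec_real a) (RealScalar.vec_ne a))
              (Matrix.diagonal (RealScalar.vec a)) (realDiagonal_map (L : Type) (RealScalar.vec a) (RealScalar.vec_real a)).symm := by
  rw [← centralType_weightOneType_of_deltaPos V a Φ hΦ] at hP
  exact exists_weightOne_eq_chiSplittingLine_toHeckeCharacter_of_hasCentralTypeAt_weightOneType V a Φ s hsc hs hP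


end Summit.HodgeConjecture.CorCM.Transposition.CentralTypeAtPin

end
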